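import Literature.Computability.FineGrained.IPRenameMaskLoop
import HarnessLib

/-!
# The renaming machine of Impagliazzo–Paturi's Lemma 2, XX: parsing, the masks, the whole program

Family `fine-grained` (trunk T-CPLX-FINE). Twentieth file of the machine half of
Impagliazzo–Paturi, *On the complexity of k-SAT*, JCSS 62 (2001), Lemma 2 (the named fact
`ipRename_reduceList_computable` of `IPLemma2Assembly.lean`). The whole one-formula renaming
machine `ipMain k cap len a b` as a structured stack program over `Γ'`, and its specification
**`runs_ipMain`**: started with `KCNF.encode φ` in `inp` (all other registers empty) it ends with
`KCNF.encodeList (IPRename.reduceList k cap len (ipThreshold a b φ.numVars) φ)` in `out` (all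
other registers empty), within the symbolic cost `ipMainCost` (bounded polynomially in the
sequel).

* parsing: `hdrPop` (the binary header onto `hdr`, most significant digit on top), `toUnary`
  (Horner: `n` in unary into `nun`), `mulA a` / `divB b` / `mkThr a b` (the threshold
  `⌈a n / b⌉ = (a n + b - 1) / b` in unary into `thr`), the clauses into `fam`;
* `ocBuild` (`IPRenameOccTable.lean`), then `masksProg` — `maskStep` (`IPRenameMaskLoop.lean`)
  for every mask of `tuples (numCols k cap)` in order, baked into the program —, then the
  accumulator is poured into `out` and the data registers are cleared;
* the identification of the output with `KCNF.encodeList (reduceList …)` is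
  `accW_eq_encodeList` per mask and `reduceList_eq_numNB` (`sizesNB = sizes.take numNB`).

## References

* R. Impagliazzo, R. Paturi, *On the complexity of k-SAT*, J. Comput. System Sci. 62 (2001)
  367–375, doi:10.1006/jcss.2000.1727, Lemma 2 (p. 373) and its "Moreover" sentence ("F̄ can be
  computed from F in time poly(n) 2^{2εn}"); conference version: *Complexity of k-SAT*, Proc.
  14th IEEE CCC (1999), doi:10.1109/ccc.1999.766282, Theorem 2 (p. 4).
* T. Nipkow, G. Klein, *Concrete Semantics with Isabelle/HOL*, Springer 2014, Ch. 7 (big-step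
  reasoning about loops, as in `SymbolPrograms.lean`).
-/

namespace Literature.Computability.FineGrained.IPRenameM

open _root_.Computability Complexity Complexity.ACom Sparsifier IPRename
open Compaction (uflag uflag_true uflag_false)

/-! ### The work registers during parsing and finishing -/

/-- The work registers during parsing and finishing: the listed registers, everything else empty.
[folklore] -/
def pT (inp hdr nun thr fam oc u1 u2 s4 out : List Γ') : AStore Γ' KR := fun x =>
  if x = KR.inp then inp else if x = KR.hdr then hdr else if x = KR.nun then nun else if x = KR.thr then thr else if x = KR.fam then fam else if x = KR.oc then oc else if x = KR.u1 then u1 else if x = KR.u2 then u2 else if x = KR.s4 then s4 else if x = KR.out then out else []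

section PTLemmas

variable (inp hdr nun thr fam oc u1 u2 s4 out w : List Γ')

/-- Reading `inp`. [folklore] -/
@[simp] theorem pT_inp : pT inp hdr nun thr fam oc u1 u2 s4 out KR.inp = inp := by simp [pT]
/-- Reading `hdr`. [folklore] -/
@[simp] theorem pT_hdr : pT inp hdr nun thr fam oc u1 u2 s4 out KR.hdr = hdr := by simp [pT]
/-- Reading `nun`. [folklore] -/
@[simp] theorem pT_nun : pT inp hdr nun thr fam oc u1 u2 s4 out KR.nun = nun := by simp [pT]
/-- Reading `thr`. [folklore] -/
@[simp] theorem pT_thr : pT inp hdr nun thr fam oc u1 u2 s4 out KR.thr = thr := by simp [pT]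
/-- Reading `fam`. [folklore] -/
@[simp] theorem pT_fam : pT inp hdr nun thr fam oc u1 u2 s4 out KR.fam = fam := by simp [pT]
/-- Reading `oc`. [folklore] -/
@[simp] theorem pT_oc : pT inp hdr nun thr fam oc u1 u2 s4 out KR.oc = oc := by simp [pT]
/-- Reading `u1`. [folklore] -/
@[simp] theorem pT_u1 : pT inp hdr nun thr fam oc u1 u2 s4 out KR.u1 = u1 := by simp [pT]
/-- Reading `u2`. [folklore] -/
@[simp] theorem pT_u2 : pT inp hdr nun thr fam oc u1 u2 s4 out KR.u2 = u2 := by simp [pT]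
/-- Reading `s4`. [folklore] -/
@[simp] theorem pT_s4 : pT inp hdr nun thr fam oc u1 u2 s4 out KR.s4 = s4 := by simp [pT]
/-- Reading `out`. [folklore] -/
@[simp] theorem pT_out : pT inp hdr nun thr fam oc u1 u2 s4 out KR.out = out := by simp [pT]
/-- Reading any other register. [folklore] -/
theorem pT_other {x : KR} (h0 : x ≠ KR.inp) (h1 : x ≠ KR.hdr) (h2 : x ≠ KR.nun) (h3 : x ≠ KR.thr) (h4 : x ≠ KR.fam) (h5 : x ≠ KR.oc) (h6 : x ≠ KR.u1) (h7 : x ≠ KR.u2) (h8 : x ≠ KR.s4) (h9 : x ≠ KR.out) :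
    pT inp hdr nun thr fam oc u1 u2 s4 out x = [] := by simp [pT, h0, h1, h2, h3, h4, h5, h6, h7, h8, h9]
/-- Updating `inp`. [folklore] -/
@[simp] theorem update_pT_inp : Function.update (pT inp hdr nun thr fam oc u1 u2 s4 out) KR.inp w = pT w hdr nun thr fam oc u1 u2 s4 out := by
  funext x; by_cases h : x = KR.inp
  · subst h; simp
  · rw [Function.update_of_ne h]; simp [pT, h]
/-- Updating `hdr`. [folklore] -/
@[simp] theorem update_pT_hdr : Function.update (pT inp hdr nun thr fam oc u1 u2 s4 out) KR.hdr w = pT inp w nun thr fam oc u1 u2 s4 out := by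
  funext x; by_cases h : x = KR.hdr
  · subst h; simp
  · rw [Function.update_of_ne h]; simp [pT, h]
/-- Updating `nun`. [folklore] -/
@[simp] theorem update_pT_nun : Function.update (pT inp hdr nun thr fam oc u1 u2 s4 out) KR.nun w = pT inp hdr w thr fam oc u1 u2 s4 out := by
  funext x; by_cases h : x = KR.nun
  · subst h; simp
  · rw [Function.update_of_ne h]; simp [pT, h]
/-- Updating `thr`. [folklore] -/
@[simp] theorem update_pT_thr : Function.update (pT inp hdr nun thr fam oc u1 u2 s4 out) KR.thr w = pT inp hdr nun w fam oc u1 u2 s4 out := by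
  funext x; by_cases h : x = KR.thr
  · subst h; simp
  · rw [Function.update_of_ne h]; simp [pT, h]
/-- Updating `fam`. [folklore] -/
@[simp] theorem update_pT_fam : Function.update (pT inp hdr nun thr fam oc u1 u2 s4 out) KR.fam w = pT inp hdr nun thr w oc u1 u2 s4 out := by
  funext x; by_cases h : x = KR.fam
  · subst h; simp
  · rw [Function.update_of_ne h]; simp [pT, h]
/-- Updating `oc`. [folklore] -/
@[simp] theorem update_pT_oc : Function.update (pT inp hdr nun thr fam oc u1 u2 s4 out) KR.oc w = pT inp hdr nun thr fam w u1 u2 s4 out := by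
  funext x; by_cases h : x = KR.oc
  · subst h; simp
  · rw [Function.update_of_ne h]; simp [pT, h]
/-- Updating `u1`. [folklore] -/
@[simp] theorem update_pT_u1 : Function.update (pT inp hdr nun thr fam oc u1 u2 s4 out) KR.u1 w = pT inp hdr nun thr fam oc w u2 s4 out := by
  funext x; by_cases h : x = KR.u1
  · subst h; simp
  · rw [Function.update_of_ne h]; simp [pT, h]
/-- Updating `u2`. [folklore] -/
@[simp] theorem update_pT_u2 : Function.update (pT inp hdr nun thr fam oc u1 u2 s4 out) KR.u2 w = pT inp hdr nun thr fam oc u1 w s4 out := by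
  funext x; by_cases h : x = KR.u2
  · subst h; simp
  · rw [Function.update_of_ne h]; simp [pT, h]
/-- Updating `s4`. [folklore] -/
@[simp] theorem update_pT_s4 : Function.update (pT inp hdr nun thr fam oc u1 u2 s4 out) KR.s4 w = pT inp hdr nun thr fam oc u1 u2 w out := by
  funext x; by_cases h : x = KR.s4
  · subst h; simp
  · rw [Function.update_of_ne h]; simp [pT, h]
/-- Updating `out`. [folklore] -/
@[simp] theorem update_pT_out : Function.update (pT inp hdr nun thr fam oc u1 u2 s4 out) KR.out w = pT inp hdr nun thr fam oc u1 u2 s4 w := by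
  funext x; by_cases h : x = KR.out
  · subst h; simp
  · rw [Function.update_of_ne h]; simp [pT, h]

end PTLemmas


/-- The input store is a level store. [folklore] -/
theorem single_inp_eq (w : List Γ') : AStore.single (kr KR.inp) w = vS [] (pT w [] [] [] [] [] [] [] [] []) := by
  funext r
  rcases r with y | x
  · cases y <;> rfl
  · by_cases h : x = KR.inp
    · subst h; simp [AStore.single]
    · rw [AStore.single_of_ne (by simpa using h)]
      simp [pT, h]

/-- The output store is a level store. [folklore] -/
theorem single_out_eq (w : List Γ') : AStore.single (kr KR.out) w = vS [] (pT [] [] [] [] [] [] [] [] [] w) := by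
  funext r
  rcases r with y | x
  · cases y <;> rfl
  · by_cases h : x = KR.out
    · subst h; simp [AStore.single]
    · rw [AStore.single_of_ne (by simpa using h)]
      simp [pT, h]

/-- After parsing and the occurrence table, the base hypotheses of the mask level hold. [folklore] -/
theorem mbase_pT (cap : ℕ) (F : List (List (ℕ × Bool))) (n t : ℕ) :
    MBase (pT [] [] (ticks Γ'.blank n) (ticks Γ'.blank t) (wFam F) (wRecs (ocRecs F cap (occList F))) [] [] [] []) cap F n t :=
  { fam := by simp [pT], oc := by simp [pT], nun := by simp [pT], thr := by simp [pT], vw := by simp [pT], fnd := by simp [pT], ex := by simp [pT], eb := by simp [pT], lmd := by simp [pT], ne := by simp [pT], x2 := by simp [pT], t1 := by simp [pT], t2 := by simp [pT], btw := by simp [pT], md2 := by simp [pT], pt := by simp [pT], pf := by simp [pT], lpol := by simp [pT], allf := by simp [pT], ft := by simp [pT], ff := by simp [pT], gt := by simp [pT], gf := by simp [pT], done := by simp [pT], ru := by simp [pT], cntf := by simp [pT], ytw := by simp [pT], yv := by simp [pT], clw := by simp [pT], md := by simp [pT], pol := by simp [pT], tag := by simp [pT], pr := by simp [pT], blk :=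 by simp [pT], iu2 := by simp [pT], pos := by simp [pT], res := by simp [pT], val := by simp [pT], cl := by simp [pT], c2 := by simp [pT], u1 := by simp [pT], fl2 := by simp [pT], fl3 := by simp [pT], iu := by simp [pT], s0 := by simp [pT], ac2 := by simp [pT], s7 := by simp [pT], s1 := by simp [pT], s3 := by simp [pT], u2 := by simp [pT], cnt := by simp [pT], ycnt := by simp [pT], s6 := by simp [pT], fl := by simp [pT], fv2 := by simp [pT], szs2 := by simp [pT], yt := by simp [pT], u3 := by simp [pT], ju := by simp [pT], hd2 := by simp [pT], s4 := by simp [pT], oc2 := by simp [pT], dict2 := by simp [pT], c := by simp [pT], sat := by simp [pT], posc := by simp [pT], fam2 := by simp [pT], key := by simp [pT], pr2 := by simp [pT], s2 := by simp [pT], s5 := by simp [pT], dict := by simp [pT], na := by simp [pT], ac := by simp [pT], bt := by simp [pT], szs := by simp [pT], fv := by simp [pT] }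

/-- Before the occurrence table: the hypotheses of `ocBuild`. [folklore] -/
theorem nvBase_pT (cap : ℕ) (F : List (List (ℕ × Bool))) (n t : ℕ) :
    NvBase (vS [] (pT [] [] (ticks Γ'.blank n) (ticks Γ'.blank t) (wFam F) [] [] [] [] [])) F cap [] :=
  { fam := by simp [pT], oc := by simp [pT, ocRecs, wRecs], pr2 := by simp [pT], t1 := by simp [pT], t2 := by simp [pT], x2 := by simp [pT], vw := by simp [pT], eb := by simp [pT], lmd := by simp [pT], dict2 := by simp [pT], s1 := by simp [pT], md := by simp [pT], ex := by simp [pT], ju := by simp [pT], fl := by simp [pT], cnt := by simp [pT], s2 := by simp [pT], cols := by simp [pT], ne := by simp [pT], fnd := by simp [pT], key := by simp [pT], c := by simp [pT], u2 := by simp [pT], u3 := by simp [pT], s3 := by simp [pT], s4 := by simp [pT], s5 := by simp [pT], fl2 := by simp [pT], fl3 := by simp [pT] }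


/-! ### Parsing the header -/

/-- Move the binary header of the input onto `hdr` (reversed: most significant digit on top),
consuming the comma that closes it. [folklore] -/
def hdrPop : RProg :=
  push (kr KR.s4) Γ'.blank ;; whileLoop (kr KR.s4) (pop (kr KR.inp) fun o => match o with
    | some (Γ'.bit d) => push (kr KR.hdr) (Γ'.bit d) ;; push (kr KR.s4) Γ'.blank
    | _ => skip)

/-- The store of `hdrPop` before iteration `i`. [folklore] -/
def hpS (bs : List Bool) (rest nun thr fam oc u1 u2 out : List Γ') (i : ℕ) : RStore :=
  vS [] (pT (if i ≤ bs.length then (bs.drop i).map Γ'.bit ++ Γ'.comma :: rest else rest) ((bs.take i).map Γ'.bit).reverse nun thr fam oc u1 u2 [] out)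

/-- **`hdrPop`.** [folklore] -/
theorem runs_hdrPop (bs : List Bool) (rest nun thr fam oc u1 u2 out : List Γ') :
    Runs hdrPop (vS [] (pT (bs.map Γ'.bit ++ Γ'.comma :: rest) [] nun thr fam oc u1 u2 [] out))
      (vS [] (pT rest (bs.map Γ'.bit).reverse nun thr fam oc u1 u2 [] out)) (6 * (bs.length + 1) + 2) := by
  have eN : hpS bs rest nun thr fam oc u1 u2 out (bs.length + 1) = vS [] (pT rest (bs.map Γ'.bit).reverse nun thr fam oc u1 u2 [] out) := by
    simp [hpS, List.take_of_length_le (Nat.le_succ _)]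
  have e0 : hpS bs rest nun thr fam oc u1 u2 out 0 = vS [] (pT (bs.map Γ'.bit ++ Γ'.comma :: rest) [] nun thr fam oc u1 u2 [] out) := by
    simp [hpS]
  unfold hdrPop
  have h0 : Runs (push (kr KR.s4) Γ'.blank) (hpS bs rest nun thr fam oc u1 u2 out 0) (Function.update (hpS bs rest nun thr fam oc u1 u2 out 0) (kr KR.s4) [Γ'.blank]) 1 :=
    Runs.push' (by rw [e0]; simp)
  have h1 := runs_whileLoop (kr KR.s4) Γ'.blank (pop (kr KR.inp) fun o => match o with
      | some (Γ'.bit d) => push (kr KR.hdr) (Γ'.bit d) ;; push (kr KR.s4) Γ'.blank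
      | _ => skip) (hpS bs rest nun thr fam oc u1 u2 out) (bs.length + 1) 4 (Nat.succ_pos _)
    (fun i => by simp [hpS]) (fun i hi => by
      by_cases hlt : i < bs.length
      · -- a header bit
        have hk : hpS bs rest nun thr fam oc u1 u2 out i (kr KR.inp) = Γ'.bit (bs[i]) :: ((bs.drop (i + 1)).map Γ'.bit ++ Γ'.comma :: rest) := by
          simp only [hpS, vS_kr, pT_inp, if_pos hlt.le]
          rw [List.drop_eq_getElem_cons hlt, List.map_cons, List.cons_append]
        refine (Runs.pop_cons hk ((Runs.push' rfl).seq (Runs.push' ?_))).of_eq rfl (by norm_num)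
        rw [if_pos (by omega)]
        simp only [hpS, update_vS_kr, update_pT_inp, update_pT_hdr, update_pT_s4, if_pos (Nat.succ_le_of_lt hlt), vS_kr, pT_hdr, pT_s4]
        rw [show (List.map Γ'.bit (List.take (i + 1) bs)).reverse = Γ'.bit bs[i] :: (List.map Γ'.bit (List.take i bs)).reverse by
          rw [List.take_add_one, List.getElem?_eq_getElem hlt, Option.toList_some, List.map_append, List.reverse_append]; rfl]
      · -- the comma
        have hi' : i = bs.length := by omega
        subst hi'
        have hk : hpS bs rest nun thr fam oc u1 u2 out bs.length (kr KR.inp) = Γ'.comma :: rest := by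
          simp [hpS]
        refine (Runs.pop_cons hk ((Runs.skip _).of_eq ?_ le_rfl)).of_eq rfl (by norm_num)
        rw [if_neg (lt_irrefl _)]
        simp only [hpS, update_vS_kr, update_pT_inp, update_pT_s4, if_neg (Nat.not_succ_le_self _), le_refl, if_true,
          List.take_of_length_le (Nat.le_succ _), List.take_length])
  rw [e0] at h0 h1
  rw [eN] at h1
  refine (h0.seq h1).of_eq rfl (by omega)

/-! ### The header in unary -/

/-- Horner evaluation of binary digits, most significant first, onto an accumulator. [folklore] -/
def horner : List Bool → ℕ → ℕ
  | [], a => a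
  | b :: bs, a => horner bs (2 * a + b.toNat)

/-- Horner evaluation of the reversed little-endian numeral is its value. [folklore] -/
theorem horner_reverse (bs : List Bool) (a : ℕ) : horner bs.reverse a = a * 2 ^ bs.length + bitsToNat bs := by
  induction bs using List.reverseRecOn generalizing a with
  | nil => simp [horner]
  | append_singleton l b ih =>
    rw [List.reverse_append, List.reverse_singleton, List.singleton_append, horner, ih, bitsToNat_append, List.length_append,
      List.length_singleton, pow_succ]
    simp only [bitsToNat_cons, bitsToNat_nil]
    ring

/-- The accumulator only grows. [folklore] -/
theorem le_horner : ∀ (bs : List Bool) (a : ℕ), a ≤ horner bs a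
  | [], _ => le_rfl
  | b :: bs, a => (show a ≤ 2 * a + b.toNat by omega).trans (le_horner bs _)

/-- Double the unary register `nun` (through `u1`). [folklore] -/
def dbl : RProg := loop (kr KR.nun) (fun _ => push (kr KR.u1) Γ'.blank ;; push (kr KR.u1) Γ'.blank) ;; pour (kr KR.u1) (kr KR.nun)

/-- The doubling loop. [folklore] -/
theorem runs_dblLoop : ∀ (v : ℕ) (R : RStore) (u : List Γ'), R (kr KR.nun) = ticks Γ'.blank v → R (kr KR.u1) = u →
    Runs (loop (kr KR.nun) fun _ => push (kr KR.u1) Γ'.blank ;; push (kr KR.u1) Γ'.blank) R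
      (Function.update (Function.update R (kr KR.nun) []) (kr KR.u1) (ticks Γ'.blank (2 * v) ++ u)) (4 * v + 1)
  | 0, R, u, hn, hu => by
    refine (Runs.loop_nil _ hn).of_eq ?_ (by simp)
    rw [Nat.mul_zero, ticks_zero, List.nil_append, ← hu, Function.update_eq_self_iff.2 (by simp), Function.update_eq_self_iff.2 hn.symm]
  | v + 1, R, u, hn, hu => by
    rw [ticks_succ] at hn
    have hb : Runs (push (kr KR.u1) Γ'.blank ;; push (kr KR.u1) Γ'.blank) (Function.update R (kr KR.nun) (ticks Γ'.blank v))
        (Function.update (Function.update R (kr KR.nun) (ticks Γ'.blank v)) (kr KR.u1) (Γ'.blank :: Γ'.blank :: u)) (1 + 1) :=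
      (Runs.push' rfl).seq (Runs.push' (by simp [hu]))
    have ih := runs_dblLoop v (Function.update (Function.update R (kr KR.nun) (ticks Γ'.blank v)) (kr KR.u1) (Γ'.blank :: Γ'.blank :: u))
      (Γ'.blank :: Γ'.blank :: u) (by simp) (by simp)
    have e2 : ticks Γ'.blank (2 * v) ++ Γ'.blank :: Γ'.blank :: u = ticks Γ'.blank (2 * (v + 1)) ++ u := by
      rw [show 2 * (v + 1) = 2 * v + 1 + 1 by ring]
      simp [ticks, List.replicate_succ', List.append_assoc]
    refine (Runs.loop_cons hn hb ih).of_eq ?_ (by omega)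
    funext q
    by_cases q1 : q = kr KR.u1
    · subst q1; simp [e2]
    by_cases q2 : q = kr KR.nun; · subst q2; simp
    simp [q1, q2]

/-- **`dbl`.** [folklore] -/
theorem runs_dbl (v : ℕ) (R : RStore) (hn : R (kr KR.nun) = ticks Γ'.blank v) (hu : R (kr KR.u1) = []) :
    Runs dbl R (Function.update R (kr KR.nun) (ticks Γ'.blank (2 * v))) (10 * v + 2) := by
  unfold dbl
  have h1 := runs_dblLoop v R [] hn hu
  rw [List.append_nil] at h1
  have h2 := runs_pour (a := kr KR.u1) (b := kr KR.nun) (by simp) (Function.update (Function.update R (kr KR.nun) []) (kr KR.u1) (ticks Γ'.blank (2 * v)))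
  simp only [Function.update_self, Function.update_idem, ne_eq, reduceCtorEq, not_false_eq_true, Sum.inr.injEq,
    Function.update_of_ne, List.append_nil, length_ticks] at h2
  refine (h1.seq h2).of_eq ?_ (by omega)
  rw [Function.update_comm (by simp), Function.update_idem, Function.update_eq_self_iff.2 (by rw [Function.update_of_ne (by simp)]; exact hu.symm)]
  simp [ticks]

/-- `toUnary`: Horner evaluation of the header digits (most significant on top of `hdr`, consumed)
into the unary register `nun`. [folklore] -/
def toUnary : RProg := loop (kr KR.hdr) fun s => dbl ;; (match s with
  | Γ'.bit true => push (kr KR.nun) Γ'.blank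
  | _ => skip)

/-- **`toUnary`** (with `W` bounding the final value). [folklore] -/
theorem runs_toUnary : ∀ (bs : List Bool) (v W : ℕ) (R : RStore), R (kr KR.hdr) = bs.map Γ'.bit → R (kr KR.nun) = ticks Γ'.blank v →
    R (kr KR.u1) = [] → horner bs v ≤ W →
    Runs toUnary R (Function.update (Function.update R (kr KR.hdr) []) (kr KR.nun) (ticks Γ'.blank (horner bs v))) ((10 * W + 5) * bs.length + 1)
  | [], v, W, R, hh, hn, _, _ => by
    refine (Runs.loop_nil _ hh).of_eq ?_ (by simp)
    rw [horner, ← hn, Function.update_eq_self_iff.2 (by simp), Function.update_eq_self_iff.2 hh.symm]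
  | b :: bs, v, W, R, hh, hn, hu, hW => by
    rw [List.map_cons] at hh
    have hvW : v ≤ W := ((show v ≤ 2 * v + b.toNat by omega).trans (le_horner bs _)).trans hW
    have h1 := runs_dbl v (Function.update R (kr KR.hdr) (bs.map Γ'.bit)) (by simp [hn]) (by simp [hu])
    have h2 : Runs (match Γ'.bit b with
        | Γ'.bit true => push (kr KR.nun) Γ'.blank
        | _ => skip) (Function.update (Function.update R (kr KR.hdr) (bs.map Γ'.bit)) (kr KR.nun) (ticks Γ'.blank (2 * v)))
        (Function.update (Function.update R (kr KR.hdr) (bs.map Γ'.bit)) (kr KR.nun) (ticks Γ'.blank (2 * v + b.toNat))) 1 := by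
      cases b with
      | true => exact Runs.push' (by simp [ticks_succ])
      | false => exact (Runs.skip _).of_eq (by simp) (by norm_num)
    have ih := runs_toUnary bs (2 * v + b.toNat) W (Function.update (Function.update R (kr KR.hdr) (bs.map Γ'.bit)) (kr KR.nun) (ticks Γ'.blank (2 * v + b.toNat)))
      (by simp) (by simp) (by simp [hu]) hW
    unfold toUnary at ih ⊢
    refine (Runs.loop_cons hh (h1.seq h2) ih).of_eq ?_ ?_
    · rw [horner]
      funext q
      by_cases q1 : q = kr KR.nun; · subst q1; simp
      by_cases q2 : q = kr KR.hdr; · subst q2; simp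
      simp [q1, q2]
    · simp only [List.length_cons]; nlinarith

/-! ### The threshold in unary -/

/-- `mulA a`: `u2 := a · n` ticks from the unary `nun` (kept; through a copy in `u1`). [folklore] -/
def mulA (a : ℕ) : RProg :=
  copyToG (kr KR.nun) (kr KR.u1) (kr KR.t1) (kr KR.t2) ;; loop (kr KR.u1) fun _ => pushList (kr KR.u2) (List.replicate a Γ'.blank)

/-- The multiplication loop. [folklore] -/
theorem runs_mulLoop (a : ℕ) : ∀ (v : ℕ) (R : RStore) (w : ℕ), R (kr KR.u1) = ticks Γ'.blank v → R (kr KR.u2) = ticks Γ'.blank w →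
    Runs (loop (kr KR.u1) fun _ => pushList (kr KR.u2) (List.replicate a Γ'.blank)) R
      (Function.update (Function.update R (kr KR.u1) []) (kr KR.u2) (ticks Γ'.blank (a * v + w))) ((a + 2) * v + 1)
  | 0, R, w, hu, hw => by
    refine (Runs.loop_nil _ hu).of_eq ?_ (by simp)
    rw [Nat.mul_zero, Nat.zero_add, ← hw, Function.update_eq_self_iff.2 (by simp), Function.update_eq_self_iff.2 hu.symm]
  | v + 1, R, w, hu, hw => by
    rw [ticks_succ] at hu
    have hb := runs_pushList (kr KR.u2) (List.replicate a Γ'.blank) (Function.update R (kr KR.u1) (ticks Γ'.blank v))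
    rw [List.reverse_replicate, List.length_replicate, Function.update_of_ne (by simp), hw] at hb
    have e : List.replicate a Γ'.blank ++ ticks Γ'.blank w = ticks Γ'.blank (a + w) := by unfold ticks; rw [List.replicate_add]
    rw [e] at hb
    have ih := runs_mulLoop a v (Function.update (Function.update R (kr KR.u1) (ticks Γ'.blank v)) (kr KR.u2) (ticks Γ'.blank (a + w))) (a + w)
      (by simp) (by simp)
    refine (Runs.loop_cons hu hb ih).of_eq ?_ ?_
    · rw [show a * v + (a + w) = a * (v + 1) + w by ring]
      funext q
      by_cases q1 : q = kr KR.u2; · subst q1; simp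
      by_cases q2 : q = kr KR.u1; · subst q2; simp
      simp [q1, q2]
    · nlinarith

/-- **`mulA`.** [folklore] -/
theorem runs_mulA (a n : ℕ) (R : RStore) (hn : R (kr KR.nun) = ticks Γ'.blank n) (hu1 : R (kr KR.u1) = []) (hu2 : R (kr KR.u2) = [])
    (ht1 : R (kr KR.t1) = []) (ht2 : R (kr KR.t2) = []) :
    Runs (mulA a) R (Function.update R (kr KR.u2) (ticks Γ'.blank (a * n))) ((10 * n + 3) + ((a + 2) * n + 1)) := by
  unfold mulA
  have h1 := runs_copyToG (a := kr KR.nun) (b := kr KR.u1) (t₁ := kr KR.t1) (t₂ := kr KR.t2) (by simp) (by simp) (by simp) (by simp) (by simp) (by simp) R ht1 ht2 hu1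
  rw [hn] at h1
  have h2 := runs_mulLoop a n (Function.update R (kr KR.u1) (ticks Γ'.blank n)) 0 (by simp) (by simp [hu2])
  have eu1 : Function.update R (kr KR.u1) [] = R := Function.update_eq_self_iff.2 hu1.symm
  rw [Function.update_idem, Nat.add_zero, eu1] at h2
  simpa using h1.seq h2

/-- `divB b`: `thr := ⌊x / b⌋` ticks from `u2 = x` ticks (consumed), `b ≥ 1` baked in. [folklore] -/
def divB (b : ℕ) : RProg :=
  push (kr KR.s4) Γ'.blank ;; whileLoop (kr KR.s4) (atLeast (kr KR.u2) b (push (kr KR.thr) Γ'.blank ;; push (kr KR.s4) Γ'.blank) skip)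

/-- The store of `divB` before iteration `i`. [folklore] -/
def dvS (R : RStore) (x b : ℕ) (i : ℕ) : RStore :=
  Function.update (Function.update R (kr KR.u2) (ticks Γ'.blank (x - i * b))) (kr KR.thr) (ticks Γ'.blank (min i (x / b)))

/-- Reading `u2`. [folklore] -/
@[simp] theorem dvS_u2 (R : RStore) (x b i : ℕ) : dvS R x b i (kr KR.u2) = ticks Γ'.blank (x - i * b) := by simp [dvS]

/-- Reading `thr`. [folklore] -/
@[simp] theorem dvS_thr (R : RStore) (x b i : ℕ) : dvS R x b i (kr KR.thr) = ticks Γ'.blank (min i (x / b)) := by simp [dvS]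

/-- Reading any other register. [folklore] -/
theorem dvS_other (R : RStore) (x b i : ℕ) {r : Reg} (h1 : r ≠ kr KR.u2) (h2 : r ≠ kr KR.thr) : dvS R x b i r = R r := by
  simp [dvS, h1, h2]

/-- **`divB`.** [folklore] -/
theorem runs_divB {b : ℕ} (hb : 0 < b) (x : ℕ) (R : RStore) (hu2 : R (kr KR.u2) = ticks Γ'.blank x) (hthr : R (kr KR.thr) = []) (hs4 : R (kr KR.s4) = []) :
    Runs (divB b) R (Function.update (Function.update R (kr KR.u2) []) (kr KR.thr) (ticks Γ'.blank (x / b))) ((2 * b + 4) * (x / b + 1) + 2) := by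
  have hqx : x / b * b ≤ x := Nat.div_mul_le_self x b
  have hxq : x < x / b * b + b := Nat.lt_div_mul_add hb
  have e0 : dvS R x b 0 = R := by
    unfold dvS
    rw [Nat.zero_mul, Nat.sub_zero, Nat.zero_min, ticks_zero, ← hthr, Function.update_eq_self_iff.2 (by rw [Function.update_of_ne (by simp)]),
      Function.update_eq_self_iff.2 hu2.symm]
  have eN : dvS R x b (x / b + 1) = Function.update (Function.update R (kr KR.u2) []) (kr KR.thr) (ticks Γ'.blank (x / b)) := by
    unfold dvS
    rw [show x - (x / b + 1) * b = 0 by rw [Nat.succ_mul]; omega, ticks_zero, Nat.min_eq_right (Nat.le_succ _)]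
  unfold divB
  have h0 : Runs (push (kr KR.s4) Γ'.blank) R (Function.update (dvS R x b 0) (kr KR.s4) [Γ'.blank]) 1 := Runs.push' (by rw [e0, hs4])
  have hgo : ∀ i, dvS R x b i (kr KR.s4) = [] := fun i => by rw [dvS_other _ _ _ _ (by simp) (by simp)]; exact hs4
  have h1 := runs_whileLoop (kr KR.s4) Γ'.blank (atLeast (kr KR.u2) b (push (kr KR.thr) Γ'.blank ;; push (kr KR.s4) Γ'.blank) skip)
    (dvS R x b) (x / b + 1) (2 + 2 * b) (Nat.succ_pos _) hgo (fun i hi => by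
      by_cases hiq : i < x / b
      · -- at least `b` ticks left: one more tick on `thr`
        have hge : b ≤ x - i * b := by
          have : (i + 1) * b ≤ x / b * b := Nat.mul_le_mul_right _ hiq
          rw [Nat.succ_mul] at this; omega
        refine Runs.atLeast_ge (k := kr KR.u2) (n := b) (by simp; omega) ?_
        have e1 : Function.update (dvS R x b i) (kr KR.u2) ((dvS R x b i (kr KR.u2)).drop b) =
            Function.update (Function.update R (kr KR.u2) (ticks Γ'.blank (x - (i + 1) * b))) (kr KR.thr) (ticks Γ'.blank i) := by
          rw [dvS_u2, dvS, Function.update_comm (by simp), Function.update_idem, Nat.min_eq_left hiq.le, Function.update_comm (by simp)]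
          simp only [ticks, List.drop_replicate, Nat.succ_mul, Nat.sub_sub]
          exact Function.update_comm (by simp) _ _ _
        rw [e1, if_pos (by omega)]
        refine (Runs.push' rfl).seq (Runs.push' ?_)
        rw [dvS, Nat.min_eq_left (by omega : i + 1 ≤ x / b)]
        funext r
        by_cases r1 : r = kr KR.s4; · subst r1; simp [hs4]
        by_cases r2 : r = kr KR.thr; · subst r2; simp [ticks_succ]
        by_cases r3 : r = kr KR.u2; · subst r3; simp
        simp [r1, r2, r3]
      · -- fewer than `b` ticks left: stop
        have hi' : i = x / b := by omega
        subst hi'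
        have hlt : (dvS R x b (x / b) (kr KR.u2)).length < b := by simp; omega
        have es4 : Function.update (dvS R x b (x / b + 1)) (kr KR.s4) [] = dvS R x b (x / b + 1) := Function.update_eq_self_iff.2 (hgo _).symm
        refine (Runs.atLeast_lt (k := kr KR.u2) (n := b) (A := push (kr KR.thr) Γ'.blank ;; push (kr KR.s4) Γ'.blank) hlt
          ((Runs.skip _).of_eq ?_ le_rfl)).mono (by omega)
        rw [if_neg (lt_irrefl _), es4, eN, dvS, Nat.min_self, Function.update_comm (by simp), Function.update_idem, Function.update_comm (by simp)])
  rw [e0] at h0 h1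
  rw [eN] at h1
  refine (h0.seq h1).of_eq rfl ?_
  have : (2 + 2 * b + 2) * (x / b + 1) = (2 * b + 4) * (x / b + 1) := by ring
  omega

/-- `mkThr a b`: the threshold `(a n + b - 1) / b` ticks into `thr`, from the unary `nun` (kept).
[folklore] -/
def mkThr (a b : ℕ) : RProg := mulA a ;; pushList (kr KR.u2) (List.replicate (b - 1) Γ'.blank) ;; divB b

/-- The cost of `mkThr`. [folklore] -/
def mkThrCost (a b n : ℕ) : ℕ := (10 * n + 3) + ((a + 2) * n + 1) + (b - 1) + ((2 * b + 4) * ((a * n + b - 1) / b + 1) + 2)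

/-- **`mkThr`**: `thr := ipThreshold a b n` in unary. [folklore] -/
theorem runs_mkThr {a b : ℕ} (hb : 0 < b) (n : ℕ) (R : RStore) (hn : R (kr KR.nun) = ticks Γ'.blank n) (hu1 : R (kr KR.u1) = [])
    (hu2 : R (kr KR.u2) = []) (ht1 : R (kr KR.t1) = []) (ht2 : R (kr KR.t2) = []) (hthr : R (kr KR.thr) = []) (hs4 : R (kr KR.s4) = []) :
    Runs (mkThr a b) R (Function.update R (kr KR.thr) (ticks Γ'.blank (ipThreshold a b n))) (mkThrCost a b n) := by
  unfold mkThr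
  have h1 := runs_mulA a n R hn hu1 hu2 ht1 ht2
  have h2 := runs_pushList (kr KR.u2) (List.replicate (b - 1) Γ'.blank) (Function.update R (kr KR.u2) (ticks Γ'.blank (a * n)))
  rw [List.reverse_replicate, List.length_replicate, Function.update_self, Function.update_idem] at h2
  have e : List.replicate (b - 1) Γ'.blank ++ ticks Γ'.blank (a * n) = ticks Γ'.blank (a * n + b - 1) := by
    rw [show a * n + b - 1 = (b - 1) + a * n by omega]; unfold ticks; rw [List.replicate_add]
  rw [e] at h2
  have h3 := runs_divB hb (a * n + b - 1) (Function.update R (kr KR.u2) (ticks Γ'.blank (a * n + b - 1))) (by simp)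
    (by rw [Function.update_of_ne (by simp)]; exact hthr) (by rw [Function.update_of_ne (by simp)]; exact hs4)
  have eu2 : Function.update R (kr KR.u2) [] = R := Function.update_eq_self_iff.2 hu2.symm
  rw [Function.update_idem, eu2] at h3
  refine (h1.seq (h2.seq h3)).of_eq rfl ?_
  unfold mkThrCost; omega

/-! ### Parsing the input -/

/-- **Parsing**: header onto `hdr`, `n` in unary, the threshold, the clauses into `fam`. [folklore] -/
def parseProg (a b : ℕ) : RProg :=
  hdrPop ;; toUnary ;; mkThr a b ;; pour (kr KR.inp) (kr KR.u1) ;; pour (kr KR.u1) (kr KR.fam)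

/-- The cost of parsing (`H` the number of header digits, `W` the length of the clause word).
[folklore] -/
def parseCost (a b n H W : ℕ) : ℕ := (6 * (H + 1) + 2) + ((10 * n + 5) * H + 1) + mkThrCost a b n + (3 * W + 1) + (3 * W + 1)

/-- **Parsing a formula.** [folklore] -/
theorem runs_parseProg {a b : ℕ} (hb : 0 < b) (n : ℕ) (F : List (List (ℕ × Bool))) :
    Runs (parseProg a b) (vS [] (pT (bitsN n ++ Γ'.comma :: wFam F) [] [] [] [] [] [] [] [] []))
      (vS [] (pT [] [] (ticks Γ'.blank n) (ticks Γ'.blank (ipThreshold a b n)) (wFam F) [] [] [] [] []))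
      (parseCost a b n (encodeNat n).length (wFam F).length) := by
  unfold parseProg
  -- 1. the header
  have h1 := runs_hdrPop (encodeNat n) (wFam F) [] [] [] [] [] [] []
  -- 2. unary
  have h2 := runs_toUnary (encodeNat n).reverse 0 n (vS [] (pT (wFam F) ((encodeNat n).map Γ'.bit).reverse [] [] [] [] [] [] [] []))
    (by simp [List.map_reverse]) (by simp) (by simp) (by rw [horner_reverse]; simp)
  rw [horner_reverse, List.length_reverse] at h2
  simp only [zero_mul, zero_add, bitsToNat_encodeNat, update_vS_kr, update_pT_hdr, update_pT_nun] at h2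
  -- 3. the threshold
  have h3 := runs_mkThr (a := a) hb n (vS [] (pT (wFam F) [] (ticks Γ'.blank n) [] [] [] [] [] [] [])) (by simp) (by simp) (by simp)
    (by simp [pT]) (by simp [pT]) (by simp) (by simp)
  rw [update_vS_kr, update_pT_thr] at h3
  -- 4./5. the clauses
  have h4 := runs_pour (a := kr KR.inp) (b := kr KR.u1) (by simp) (vS [] (pT (wFam F) [] (ticks Γ'.blank n) (ticks Γ'.blank (ipThreshold a b n)) [] [] [] [] [] []))
  simp only [vS_kr, pT_inp, pT_u1, List.append_nil, update_vS_kr, update_pT_inp, update_pT_u1] at h4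
  have h5 := runs_pour (a := kr KR.u1) (b := kr KR.fam) (by simp) (vS [] (pT [] [] (ticks Γ'.blank n) (ticks Γ'.blank (ipThreshold a b n)) [] [] (wFam F).reverse [] [] []))
  simp only [vS_kr, pT_u1, pT_fam, List.append_nil, List.reverse_reverse, List.length_reverse, update_vS_kr, update_pT_u1, update_pT_fam] at h5
  refine (h1.seq (h2.seq (h3.seq (h4.seq h5)))).of_eq rfl ?_
  unfold parseCost; omega

/-! ### All masks -/

/-- **The masks**: `maskStep` for every mask of the list, in order (the list is baked into the
program). [folklore] -/
def masksProg (m : ℕ) : List (List Bool) → RProg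
  | [] => skip
  | bs :: L => maskStep bs m ;; masksProg m L

/-- The words emitted for a list of masks. [folklore] -/
def wordsW (cap len : ℕ) (F : List (List (ℕ × Bool))) (n t : ℕ) (L : List (List Bool)) : List Γ' :=
  L.flatMap fun bs => accW cap len (maskOf bs) F n t (ssOf cap len (maskOf bs) F) (odoM (ssOf cap len (maskOf bs) F))

/-- The cost of a list of masks. [folklore] -/
def masksCost (cap len : ℕ) (F : List (List (ℕ × Bool))) (n t Y Lo : ℕ) (L : List (List Bool)) : ℕ :=
  (L.map fun bs => maskCost cap len (maskOf bs) F n t Y Lo bs.length).sum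

/-- **`masksProg`.** [folklore] -/
theorem runs_masksProg {T : AStore Γ' KR} {cap : ℕ} {F : List (List (ℕ × Bool))} {n t : ℕ} (hM : MBase T cap F n t) (Lo Y : ℕ)
    (hLo : (wRecs (ocRecs F cap (occList F))).length ≤ Lo) (hY : (occVars F).card ≤ Y) (len : ℕ) :
    ∀ (L : List (List Bool)) (acc : List Γ'),
      Runs (masksProg (max len 1) L) (vS acc T) (vS ((wordsW cap len F n t L).reverse ++ acc) T) (masksCost cap len F n t Y Lo L)
  | [], acc => by simpa [masksProg, wordsW, masksCost] using Runs.skip _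
  | bs :: L, acc => by
    have h1 := runs_maskStep hM Lo Y hLo hY len bs acc
    have h2 := runs_masksProg hM Lo Y hLo hY len L
      ((accW cap len (maskOf bs) F n t (ssOf cap len (maskOf bs) F) (odoM (ssOf cap len (maskOf bs) F))).reverse ++ acc)
    rw [masksProg]
    refine (h1.seq h2).of_eq ?_ ?_
    · simp [wordsW, List.reverse_append]
    · simp [masksCost]

/-! ### Finishing -/

/-- **Finishing**: the accumulator into `out` (reversal), the data registers cleared. [folklore] -/
def finishProg : RProg :=
  pour (tb TB.acc) (kr KR.out) ;; clear (kr KR.fam) ;; clear (kr KR.oc) ;; clear (kr KR.nun) ;; clear (kr KR.thr)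

/-- **`finishProg`.** [folklore] -/
theorem runs_finishProg (W nun thr fam oc : List Γ') :
    Runs finishProg (vS W.reverse (pT [] [] nun thr fam oc [] [] [] [])) (vS [] (pT [] [] [] [] [] [] [] [] [] W))
      ((3 * W.length + 1) + (2 * fam.length + 1) + (2 * oc.length + 1) + (2 * nun.length + 1) + (2 * thr.length + 1)) := by
  unfold finishProg
  have h1 := runs_pour (a := tb TB.acc) (b := kr KR.out) (by simp) (vS W.reverse (pT [] [] nun thr fam oc [] [] [] []))
  simp only [vS_acc, vS_kr, pT_out, List.append_nil, List.reverse_reverse, List.length_reverse, update_vS_acc, update_vS_kr, update_pT_out] at h1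
  have h2 := runs_clear (kr KR.fam) (vS [] (pT [] [] nun thr fam oc [] [] [] W))
  simp only [vS_kr, pT_fam, update_vS_kr, update_pT_fam] at h2
  have h3 := runs_clear (kr KR.oc) (vS [] (pT [] [] nun thr [] oc [] [] [] W))
  simp only [vS_kr, pT_oc, update_vS_kr, update_pT_oc] at h3
  have h4 := runs_clear (kr KR.nun) (vS [] (pT [] [] nun thr [] [] [] [] [] W))
  simp only [vS_kr, pT_nun, update_vS_kr, update_pT_nun] at h4
  have h5 := runs_clear (kr KR.thr) (vS [] (pT [] [] [] thr [] [] [] [] [] W))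
  simp only [vS_kr, pT_thr, update_vS_kr, update_pT_thr] at h5
  exact (h1.seq (h2.seq (h3.seq (h4.seq h5)))).of_eq rfl (by omega)

/-! ### The whole program -/

/-- **The one-formula renaming machine of Lemma 2**: parse, occurrence table, all masks, finish.
[cite: ImpagliazzoPaturiJCSS2001, Lemma 2 (p. 373), the "Moreover" sentence] -/
def ipMain (k cap len a b : ℕ) : RProg :=
  parseProg a b ;; ocBuild cap ;; masksProg (max len 1) (tuples (numCols k cap)) ;; finishProg

/-- The occurrence table of a formula. [folklore] -/
def ocTable {k : ℕ} (cap : ℕ) (φ : KCNF k) : List Γ' := wRecs (ocRecs φ.clauses cap (occList φ.clauses))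

/-- **The symbolic cost of the one-formula renaming machine** (bounded polynomially in the sequel).
[folklore] -/
noncomputable def ipMainCost (k cap len a b : ℕ) (φ : KCNF k) : ℕ :=
  parseCost a b φ.numVars (encodeNat φ.numVars).length (wFam φ.clauses).length +
  ((litOcCost φ.numVars (ocTable cap φ).length (wFam φ.clauses).length cap + 16) * (wFam φ.clauses).length + 4) +
  masksCost cap len φ.clauses φ.numVars (ipThreshold a b φ.numVars) (occVars φ.clauses).card (ocTable cap φ).length (tuples (numCols k cap)) +
  ((3 * (KCNF.encodeList (reduceList k cap len (ipThreshold a b φ.numVars) φ)).length + 1) + (2 * (wFam φ.clauses).length + 1) +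
    (2 * (ocTable cap φ).length + 1) + (2 * φ.numVars + 1) + (2 * ipThreshold a b φ.numVars + 1))

/-- The nonempty block sizes are the first `numNB` block sizes. [folklore] -/
theorem sizesNB_eq_take (P : Params) (F : List (List (ℕ × Bool))) : sizesNB P F = (sizes P F).take (numNB P F) := by
  unfold sizesNB sizes
  rw [← List.map_take, List.take_range, Nat.min_eq_left (numNB_le_numBlocks P F)]

/-- `encodeList` of a concatenation over any index list. [folklore] -/
theorem encodeList_flatMap' {α : Type} {k : ℕ} (L : List α) (R : α → List (KCNF k)) :
    KCNF.encodeList (L.flatMap R) = L.flatMap fun x => KCNF.encodeList (R x) := by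
  simp [KCNF.encodeList, List.flatMap_assoc]

/-- **The words emitted for all masks are the encoding of `reduceList`.** [folklore] -/
theorem wordsW_eq_encodeList {k : ℕ} (cap len t : ℕ) (φ : KCNF k) :
    wordsW cap len φ.clauses φ.numVars t (tuples (numCols k cap)) = KCNF.encodeList (reduceList k cap len t φ) := by
  rw [reduceList_eq_numNB, encodeList_flatMap', wordsW]
  refine List.flatMap_congr fun bs _ => ?_
  rw [accW_eq_encodeList φ cap len (maskOf bs) t (ss := ssOf cap len (maskOf bs) φ.clauses) rfl, sizesNB_eq_take]

/-- **Specification of the one-formula renaming machine.** Started with the encoding of `φ` in the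
input register, it ends with the encoding of the list `reduceList k cap len ⌈a n / b⌉ φ` in the
output register, every other register empty.
[cite: ImpagliazzoPaturiJCSS2001, Lemma 2 (p. 373), the "Moreover" sentence] -/
theorem runs_ipMain (k cap len a b : ℕ) (hb : 0 < b) (φ : KCNF k) :
    Runs (ipMain k cap len a b) (AStore.single (kr KR.inp) φ.encode)
      (AStore.single (kr KR.out) (KCNF.encodeList (reduceList k cap len (ipThreshold a b φ.numVars) φ))) (ipMainCost k cap len a b φ) := by
  set n := φ.numVars with hn
  set F := φ.clauses with hF
  set t := ipThreshold a b n with ht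
  rw [single_inp_eq, single_out_eq]
  unfold ipMain
  have eenc : φ.encode = bitsN n ++ Γ'.comma :: wFam F := rfl
  rw [eenc]
  -- 1. parse
  have h1 := runs_parseProg (a := a) hb n F
  -- 2. the occurrence table
  have hLf : ∀ c ∈ F, ∀ l ∈ c, (rbits l.1).length ≤ n := fun c hc l hl => by
    rw [rbits, List.length_reverse, List.length_map]
    exact (TokConv.length_encodeNat_le _).trans (φ.fst_lt_numVars c hc l hl).le
  have h2 := runs_ocBuild (vS [] (pT [] [] (ticks Γ'.blank n) (ticks Γ'.blank t) (wFam F) [] [] [] [] [])) F cap n (nvBase_pT cap F n t) hLf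
    (by simp [pT]) (by simp [pT])
  rw [update_vS_kr, update_pT_oc] at h2
  -- 3. the masks
  have h3 := runs_masksProg (mbase_pT cap F n t) (wRecs (ocRecs F cap (occList F))).length (occVars F).card le_rfl le_rfl len (tuples (numCols k cap)) []
  rw [List.append_nil, wordsW_eq_encodeList] at h3
  -- 4. finish
  have h4 := runs_finishProg (KCNF.encodeList (reduceList k cap len t φ)) (ticks Γ'.blank n) (ticks Γ'.blank t) (wFam F) (wRecs (ocRecs F cap (occList F)))
  refine (h1.seq (h2.seq (h3.seq h4))).of_eq rfl ?_
  simp only [length_ticks]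
  unfold ipMainCost ocTable
  rw [← hn, ← hF, ← ht]
  omega

end Literature.Computability.FineGrained.IPRenameM
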